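import Summits.FinalStateConjecture.FinalStateConjecture.Theorems.ClusterCompletenessAdiabaticMultiKerrILEDRedShiftLocalPointwise

/-!
# Route ClusterCompleteness — crux `AdiabaticMultiKerrILED`, line `Sketch`: local red-shift
# estimate, part 2/3 (the weighted estimate at fixed receding parameter)

Helper file for the crux `stmt-FinalStateConjecture-14310`
(`Summit.FinalStateConjecture.FinalStateConjecture.Theses.ClusterCompleteness.AdiabaticMultiKerrILED`),
serving the stub `stub_redShiftLocal` of line `Sketch` through the registered helper
`redShift_weighted_estimate_local`: the weighted red-shift estimate
`Literature.Geometry.Lorentzian.Kerr.redShift_weighted_estimate` (Dafermos–Rodnianski–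
Shlapentokh-Rothman arXiv:1402.7034, Prop. 4.5.2 in the form of the first display of §13.2, before
`ε → 0`; Dafermos–Rodnianski arXiv:0811.0354, §3.3.3) with the wave equation `□_B Φ = 0` assumed
only at exterior points of the collar `{r ≤ r₊ + η}` in the future of the initial leaf
`{x⁰ ≥ F(x⃗)}`. The proof is the Literature proof verbatim: the equation enters only through the
pointwise divergence bound (`redShift_weightedCurrent_divergence_le`, part 1/3), which
`E4.graphFlux_add_integral_le_of_divergence_le` requires only at points of the weight's support
`K_ε ⊆ {r ≤ r₊ + η}` lying in the slab `{F(x⃗) ≤ x⁰ ≤ s + F(x⃗)}`.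
-/

noncomputable section

-- the doubled `FinalStateConjecture.FinalStateConjecture` path component trips dupNamespace
set_option linter.dupNamespace false

open Set Filter Metric MeasureTheory
open scoped Topology ENNReal
open Literature.Geometry.Lorentzian Literature.Geometry.Lorentzian.Kerr

namespace Summit.FinalStateConjecture.FinalStateConjecture.Cruxes.AdiabaticMultiKerrILED.Sketch

/-- **The red-shift estimate between admissible graph leaves at fixed receding parameter, local
hypotheses** (Dafermos–Rodnianski–Shlapentokh-Rothman, Prop. 4.5.2, first display of §13.2, before
the limit `ε → 0`): `Kerr.redShift_weighted_estimate` with `□_B Φ = 0`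
(`B = Kerr.surgeryBackground M a r₊`) assumed only at exterior points `x` with `r(x) ≤ r₊ + η` and
`F(x⃗) ≤ x⁰`. For subextremal `(M, a)` there is `η₀ > 0` such that for `0 < η ≤ η₀` there are
`A > 0`, `C ≥ 0` with: for every `C²` height `F` of slope `∑(∂_iF)² ≤ (1 − c)²` (`0 < c ≤ 1`),
every such `Φ`, every `ε > 0`, `s ≥ 0`,
`A c ∫_{Σ̃_s} W_ε ∑(∂Φ)² + A ∫_0^s ∫_{Σ̃_u} W_ε ∑(∂Φ)²`
`  ≤ C ∫_{Σ̃_0} W_ε ∑(∂Φ)² + C ∫_0^s ∫_{Σ̃_u} (∑|∂χ|) ∑(∂Φ)²`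
(`W_ε = Kerr.redShiftWeight` for the radii `r₊ + η/2 < r₊ + η`, `Σ̃_u = {(u + F(y), y)}`,
`y`-integrals over `‖y‖ ≤ √((r₊ + η)² + a²)`). Proof:
`E4.graphFlux_add_integral_le_of_divergence_le` for the current `W_ε (−J^N + ε₀ J^{dt*})[Φ]`,
whose divergence is bounded at the slab points of `K_ε` by `redShift_weightedCurrent_divergence_le`;
leaf fluxes as in the Literature proof.
[cite: DafermosRodnianskiShlapentokhrothman2014, Prop. 4.5.2 and §13.2] -/
theorem redShift_weighted_estimate_local :
    ∀ (M a : ℝ) (hMa : Kerr.IsSubextremal M a),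
    ∃ η₀ : ℝ, 0 < η₀ ∧ ∀ η : ℝ, 0 < η → η ≤ η₀ → ∃ A C : ℝ, 0 < A ∧ 0 ≤ C ∧
      ∀ (F : E3 → ℝ) (c : ℝ), ContDiff ℝ 2 F → 0 < c → c ≤ 1 →
      (∀ y, ∑ i, Kerr.partialE3 F y i ^ 2 ≤ (1 - c) ^ 2) →
      ∀ Φ : E4 → ℝ, (∀ x ∈ (Kerr.exterior M a : Set E4), ContDiffAt ℝ 2 Φ x) →
      (∀ x ∈ (Kerr.exterior M a : Set E4), Kerr.radius a x ≤ Kerr.rPlus M a + η →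
        F (E4.spatial x) ≤ x 0 → KerrSchild.waveOperator
          (Kerr.surgeryBackground M a (Kerr.rPlus M a) hMa.pos.le hMa.rPlus_pos).inverseMetric
          Φ x = 0) →
      ∀ ε : ℝ, 0 < ε → ∀ s : ℝ, 0 ≤ s →
        A * c * (∫ y in Metric.closedBall (0 : E3) √((Kerr.rPlus M a + η) ^ 2 + a ^ 2),
            Kerr.redShiftWeight M a (Kerr.rPlus M a + η / 2) (Kerr.rPlus M a + η) ε
              (E4.ofTimeSpace (s + F y) y) *
              ∑ μ, fderiv ℝ Φ (E4.ofTimeSpace (s + F y) y) (E4.basisVector μ) ^ 2) +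
          A * ∫ u in Set.Ioc 0 s,
            ∫ y in Metric.closedBall (0 : E3) √((Kerr.rPlus M a + η) ^ 2 + a ^ 2),
            Kerr.redShiftWeight M a (Kerr.rPlus M a + η / 2) (Kerr.rPlus M a + η) ε
              (E4.ofTimeSpace (u + F y) y) *
              ∑ μ, fderiv ℝ Φ (E4.ofTimeSpace (u + F y) y) (E4.basisVector μ) ^ 2 ≤
        C * (∫ y in Metric.closedBall (0 : E3) √((Kerr.rPlus M a + η) ^ 2 + a ^ 2),
            Kerr.redShiftWeight M a (Kerr.rPlus M a + η / 2) (Kerr.rPlus M a + η) ε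
              (E4.ofTimeSpace (0 + F y) y) *
              ∑ μ, fderiv ℝ Φ (E4.ofTimeSpace (0 + F y) y) (E4.basisVector μ) ^ 2) +
          C * ∫ u in Set.Ioc 0 s,
            ∫ y in Metric.closedBall (0 : E3) √((Kerr.rPlus M a + η) ^ 2 + a ^ 2),
            (∑ μ, |fderiv ℝ (Kerr.collarCutoff a (Kerr.rPlus M a + η / 2) (Kerr.rPlus M a + η))
                (E4.ofTimeSpace (u + F y) y) (E4.basisVector μ)|) *
              ∑ μ, fderiv ℝ Φ (E4.ofTimeSpace (u + F y) y) (E4.basisVector μ) ^ 2 := by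
  intro M a hMa
  -- ### constants of the background
  have hM : 0 < M := hMa.pos
  have hrp : 0 < rPlus M a := hMa.rPlus_pos
  have hδ : 0 < rPlus M a - M := hMa.rPlus_sub_self_pos
  set hp : ℝ := 16 / (rPlus M a - M) with hhp
  have hhp16 : 16 ≤ (rPlus M a - M) * hp := by rw [hhp, mul_div_cancel₀ _ hδ.ne']
  have hp0 : 0 < hp := by positivity
  -- the collars of `N`
  obtain ⟨η₁, hη₁, b₁, hb₁, hcoer⟩ := exists_redShift_bulk_coercive hMa hhp16 hhp16
  obtain ⟨η₂, hη₂, b₂, hb₂, hcol⟩ := exists_redShift_timelike_collar hMa hp hp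
  refine ⟨min η₁ η₂, lt_min hη₁ hη₂, fun η hη hηle ↦ ?_⟩
  have hηle₁ : η ≤ η₁ := hηle.trans (min_le_left _ _)
  have hηle₂ : η ≤ η₂ := hηle.trans (min_le_right _ _)
  -- the surgered background and its bounds
  set B := surgeryBackground M a (rPlus M a) hMa.pos.le hMa.rPlus_pos with hB
  have hΦb0 : 0 ≤ B.bound := (B.φ_nonneg 0).trans (B.φ_le 0)
  obtain ⟨D, hD0, hD⟩ :=
    exists_bound_fderiv_surgeryBackground_inverseMetric hMa.pos.le a hMa.rPlus_pos
  obtain ⟨Ξ, hΞ0, hΞ⟩ :=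
    exists_abs_redShiftVector_le M a hp hp hrp (r₀ := rPlus M a) (R := rPlus M a + η)
  -- radii and the cut-off bound
  set R₁ : ℝ := rPlus M a + η / 2 with hR₁
  set R₂ : ℝ := rPlus M a + η with hR₂
  have hR₁pos : 0 < R₁ := by positivity
  have hR12 : R₁ < R₂ := by rw [hR₁, hR₂]; linarith
  have hrR₁ : rPlus M a < R₁ := by rw [hR₁]; linarith
  obtain ⟨L, hL0, hL⟩ := exists_abs_fderiv_collarCutoff_le (a := a) hR₁pos hR12
  -- the constants
  set CJ : ℝ := 6 * (1 + B.bound) * Ξ + 6 * (1 + B.bound) ^ 2 with hCJ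
  have hCJ0 : 0 ≤ CJ := by positivity
  set ε₀ : ℝ := min 1 (b₁ / (2 * (32 * (1 + B.bound) * D + 1))) with hε₀
  have hε₀pos : 0 < ε₀ := lt_min one_pos (by positivity)
  have hε₀le1 : ε₀ ≤ 1 := min_le_left _ _
  have hε₀D : ε₀ * (32 * (1 + B.bound) * D) ≤ b₁ / 2 := by
    have h1 : ε₀ ≤ b₁ / (2 * (32 * (1 + B.bound) * D + 1)) := min_le_right _ _
    have h2 : 0 ≤ 32 * (1 + B.bound) * D := by positivity
    calc ε₀ * (32 * (1 + B.bound) * D)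
        ≤ b₁ / (2 * (32 * (1 + B.bound) * D + 1)) * (32 * (1 + B.bound) * D + 1) :=
          mul_le_mul h1 (by linarith) h2 (by positivity)
      _ = b₁ / 2 := by field_simp
  set A : ℝ := min (ε₀ / 6) (b₁ / 2) with hA
  have hApos : 0 < A := lt_min (by positivity) (by positivity)
  have hAε : A ≤ ε₀ / 6 := min_le_left _ _
  have hAb : A ≤ b₁ / 2 := min_le_right _ _
  refine ⟨A, 4 * CJ, hApos, by positivity, fun F c hF hc hc1 hFc Φ hΦ hsol ε hε s hs ↦ ?_⟩
  -- ### notation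
  set ρ : ℝ := √(R₂ ^ 2 + a ^ 2) with hρ
  set G := B.inverseMetric with hG
  set N : E4 → Fin 4 → ℝ := redShiftVector M a hp hp with hN
  set χ : E4 → ℝ := collarCutoff a R₁ R₂ with hχ
  set W : E4 → ℝ := redShiftWeight M a R₁ R₂ ε with hW
  set K : Set E4 := redShiftWeightSet M a R₂ ε with hK
  set U : Set E4 := (exterior M a : Set E4) with hU
  set p2 : E4 → ℝ := fun x ↦ ∑ μ, fderiv ℝ Φ x (E4.basisVector μ) ^ 2 with hp2
  set JN : Fin 4 → E4 → ℝ := fun μ x ↦ KerrSchild.multiplierCurrent G N Φ x μ with hJN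
  set P : Fin 4 → E4 → ℝ := fun μ x ↦ KerrSchild.normalCurrent G Φ x μ with hP
  set Cur : Fin 4 → E4 → ℝ := fun μ x ↦ -JN μ x + ε₀ * P μ x with hCur
  set J : Fin 4 → E4 → ℝ := fun μ x ↦ W x * Cur μ x with hJ
  set n : E4 → Fin 4 → ℝ := fun x μ ↦ graphConormal F (E4.spatial x) μ with hn
  set V : E4 → ℝ := fun x ↦ ∑ μ, |fderiv ℝ χ x (E4.basisVector μ)| with hV
  set ℓ : E4 → ℝ := fun x ↦ b₁ / 2 * (W x * p2 x) with hℓ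
  set e : E4 → ℝ := fun x ↦ 4 * CJ * (V x * p2 x) with he
  have hp2nn : ∀ x, 0 ≤ p2 x := fun x ↦ Finset.sum_nonneg fun μ _ ↦ sq_nonneg _
  -- ### the weight and its support
  have hKc : IsClosed K := isClosed_redShiftWeightSet M a R₂ ε
  have hKU : K ⊆ U := redShiftWeightSet_subset_exterior hrp hε
  have hWK : ∀ x, W x ≠ 0 → x ∈ K := fun x hx ↦ mem_redShiftWeightSet_of_ne_zero hR12 hε hx
  have hWz : ∀ x, x ∉ K → W x = 0 := fun x hx ↦ by
    by_contra h
    exact hx (hWK x h)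
  have hW1 : ContDiff ℝ 1 W := contDiff_redShiftWeight hR₁pos hR12 hrp hε
  have hW0 : ∀ x, 0 ≤ W x := redShiftWeight_nonneg M a R₁ R₂ ε
  have hWle : ∀ x, W x ≤ 1 := redShiftWeight_le_one M a R₁ R₂ ε
  have hχ1 : ContDiff ℝ 1 χ := contDiff_collarCutoff hR₁pos hR12
  have hχ0 : ∀ x, 0 ≤ χ x := collarCutoff_nonneg a R₁ R₂
  have hV0 : ∀ x, 0 ≤ V x := fun x ↦ Finset.sum_nonneg fun μ _ ↦ abs_nonneg _
  -- geometry of the points of `K`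
  have hKr : ∀ x ∈ K, rPlus M a < radius a x := fun x hx ↦
    rPlus_lt_radius_of_mem_redShiftWeightSet hε hx
  have hKR₂ : ∀ x ∈ K, radius a x ≤ rPlus M a + η := fun x hx ↦ hx.2
  have hKabs : ∀ x ∈ K, |radius a x - rPlus M a| ≤ η := fun x hx ↦ by
    rw [abs_of_pos (sub_pos.mpr (hKr x hx))]
    linarith [hKR₂ x hx]
  have hUpos : ∀ x ∈ U, 0 < radius a x := fun x hx ↦ radius_pos_of_mem_region hx
  have hUr : ∀ x ∈ U, rPlus M a < radius a x := fun x hx ↦ lt_radius_of_mem_region hx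
  -- ### regularity of the densities and currents at exterior points
  have hpν : ∀ x ∈ U, ∀ ν, ContinuousAt (fun y ↦ fderiv ℝ Φ y (E4.basisVector ν)) x := by
    intro x hx ν
    have h2 : ContDiffAt ℝ ((1 : ℕ∞) + 1 : ℕ∞) Φ x := by exact_mod_cast hΦ x hx
    exact ((h2.fderiv_right (m := 1) le_rfl).clm_apply contDiffAt_const).continuousAt
  have hp2c : ∀ x ∈ U, ContinuousAt p2 x := fun x hx ↦
    tendsto_finsetSum _ fun ν _ ↦ (hpν x hx ν).pow 2
  have hP1 : ∀ μ, ∀ x ∈ U, ContDiffAt ℝ 1 (P μ) x := fun μ x hx ↦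
    B.contDiffAt_normalCurrent (hΦ x hx) μ
  have hJN1 : ∀ μ, ∀ x ∈ U, ContDiffAt ℝ 1 (JN μ) x := fun μ x hx ↦
    contDiffAt_redShiftCurrent hMa hp hp (hΦ x hx) (hUpos x hx) μ
  have hCur1 : ∀ μ, ∀ x ∈ U, ContDiffAt ℝ 1 (Cur μ) x := fun μ x hx ↦
    (hJN1 μ x hx).neg.add (contDiffAt_const.mul (hP1 μ x hx))
  have hJ1 : ∀ μ, ContDiff ℝ 1 (J μ) := fun μ ↦
    contDiff_iff_contDiffAt.mpr fun x ↦ contDiffAt_weight_mul hKc hKU hW1 hWK (hCur1 μ) x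
  have hJ0 : ∀ μ x, x ∉ K → J μ x = 0 := fun μ x hx ↦ by
    simp only [hJ, hWz x hx, zero_mul]
  -- continuity of `ℓ` and `e` on `ℝ⁴`
  have hℓc : Continuous ℓ :=
    continuous_const.mul (continuous_iff_continuousAt.mpr fun x ↦
      continuousAt_weight_mul hKc hKU hW1.continuous hWz hp2c x)
  have hℓK : ∀ x, x ∉ K → ℓ x = 0 := fun x hx ↦ by
    simp only [hℓ, hWz x hx, zero_mul, mul_zero]
  set Ksh : Set E4 := {x | R₁ ≤ radius a x ∧ radius a x ≤ R₂} with hKsh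
  have hKshc : IsClosed Ksh := by
    rw [hKsh, Set.setOf_and]
    exact (isClosed_le continuous_const (continuous_radius a)).inter
      (isClosed_le (continuous_radius a) continuous_const)
  have hKshU : Ksh ⊆ U := fun x hx ↦
    mem_exterior.2 (max_lt (hrR₁.trans_le hx.1) (hrp.trans (hrR₁.trans_le hx.1)))
  have hVc : Continuous V :=
    continuous_finsetSum _ fun μ _ ↦
      ((hχ1.continuous_fderiv one_ne_zero).clm_apply continuous_const).abs
  have hVz : ∀ x, x ∉ Ksh → V x = 0 := by
    intro x hx
    refine Finset.sum_eq_zero fun μ _ ↦ ?_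
    by_contra hne
    exact hx ((hL x μ).2 (fun h0 ↦ hne (by rw [h0, abs_zero])))
  have hec : Continuous e :=
    continuous_const.mul (continuous_iff_continuousAt.mpr fun x ↦
      continuousAt_weight_mul hKshc hKshU hVc hVz hp2c x)
  have he0 : ∀ x, 0 ≤ e x := fun x ↦ mul_nonneg (by positivity) (mul_nonneg (hV0 x) (hp2nn x))
  -- spatial bound on `K`
  have hρK : ∀ x ∈ K, F (E4.spatial x) ≤ x 0 → x 0 ≤ s + F (E4.spatial x) →
      E4.spatialNorm x ≤ ρ := fun x hx _ _ ↦
    spatialNorm_le_of_mem_redShiftWeightSet hrp hε hx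
  -- ### pointwise bounds on the currents at the points of `K`
  have hΞK : ∀ x ∈ K, ∀ α, |N x α| ≤ Ξ := fun x hx α ↦ hΞ x (hKr x hx).le (hKR₂ x hx) α
  have hCurK : ∀ x ∈ K, ∀ μ, |Cur μ x| ≤ CJ * p2 x := by
    intro x hx μ
    have h1 : |JN μ x| ≤ 6 * (1 + B.bound) * Ξ * p2 x :=
      B.abs_multiplierCurrent_le Φ x (hΞK x hx) μ
    have h2 : |P μ x| ≤ 6 * (1 + B.bound) ^ 2 * p2 x := B.abs_normalCurrent_le Φ x μ
    have h3 : |ε₀ * P μ x| ≤ 6 * (1 + B.bound) ^ 2 * p2 x := by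
      rw [abs_mul, abs_of_pos hε₀pos]
      calc ε₀ * |P μ x| ≤ 1 * |P μ x| := mul_le_mul_of_nonneg_right hε₀le1 (abs_nonneg _)
        _ ≤ 6 * (1 + B.bound) ^ 2 * p2 x := by rw [one_mul]; exact h2
    calc |Cur μ x| = |-JN μ x + ε₀ * P μ x| := rfl
      _ ≤ |-JN μ x| + |ε₀ * P μ x| := abs_add_le _ _
      _ ≤ 6 * (1 + B.bound) * Ξ * p2 x + 6 * (1 + B.bound) ^ 2 * p2 x := by
          rw [abs_neg]; exact add_le_add h1 h3
      _ = CJ * p2 x := by rw [hCJ]; ring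
  -- collar facts at the points of `K`
  have hcolK : ∀ x ∈ K,
      bilin M a x (redShiftVec M a hp hp x) (redShiftVec M a hp hp x) < 0 ∧
        0 ≤ redShiftVec M a hp hp x 0 ∧
        ∀ n' ∈ admissibleConormals, 0 < ∑ μ, n' μ * N x μ := by
    intro x hx
    obtain ⟨h1, h2, h3⟩ := hcol x ((hKabs x hx).trans hηle₂)
    refine ⟨by linarith, by linarith, fun n' hn' ↦ ?_⟩
    have h4 := h3 n' hn'
    simp only [redShiftVec_apply] at h4
    exact lt_of_lt_of_le hb₂ h4
  have hnadm : ∀ x, n x ∈ admissibleConormals := fun x ↦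
    graphConormal_mem_admissibleConormals ((hFc (E4.spatial x)).trans (by nlinarith))
  -- ### the leaf flux: lower and upper bounds
  have hfluxW : ∀ x, ∑ μ, J μ x * n x μ = W x * ∑ μ, Cur μ x * n x μ := by
    intro x
    simp only [hJ, Finset.mul_sum]
    exact Finset.sum_congr rfl fun μ _ ↦ by ring
  have hqlow : ∀ x, A * c * (W x * p2 x) ≤ ∑ μ, J μ x * n x μ := by
    intro x
    rw [hfluxW x]
    by_cases hWx : W x = 0
    · simp only [hWx, zero_mul, mul_zero, le_refl]
    have hxK : x ∈ K := hWK x hWx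
    have hxr := hKr x hxK
    obtain ⟨hNN, -, hco⟩ := hcolK x hxK
    have h1 : 0 ≤ -∑ μ, JN μ x * n x μ :=
      neg_sum_redShiftCurrent_mul_nonneg hMa hxr hNN (hnadm x) (hco _ (hnadm x)) Φ
    have h2 : c * P 0 x ≤ ∑ μ, n x μ * P μ x :=
      B.mul_normalCurrent_zero_le_graphFlux Φ x hc hc1 (hFc (E4.spatial x))
    have h3 : p2 x ≤ 6 * P 0 x := B.sum_sq_le_six_mul_normalCurrent_zero Φ x
    have hsplit : ∑ μ, Cur μ x * n x μ = -∑ μ, JN μ x * n x μ + ε₀ * ∑ μ, n x μ * P μ x := by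
      simp only [hCur, Finset.mul_sum, ← Finset.sum_neg_distrib, ← Finset.sum_add_distrib]
      exact Finset.sum_congr rfl fun μ _ ↦ by ring
    rw [hsplit]
    have h4 : A * c * p2 x ≤ ε₀ * (c * P 0 x) := by
      calc A * c * p2 x ≤ ε₀ / 6 * c * (6 * P 0 x) := by gcongr
        _ = ε₀ * (c * P 0 x) := by ring
    have h5 : ε₀ * (c * P 0 x) ≤ ε₀ * ∑ μ, n x μ * P μ x := mul_le_mul_of_nonneg_left h2 hε₀pos.le
    have hWx0 : 0 ≤ W x := hW0 x
    calc A * c * (W x * p2 x) = W x * (A * c * p2 x) := by ring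
      _ ≤ W x * (-∑ μ, JN μ x * n x μ + ε₀ * ∑ μ, n x μ * P μ x) :=
          mul_le_mul_of_nonneg_left (by linarith) hWx0
  have hqup : ∀ x, ∑ μ, J μ x * n x μ ≤ 4 * CJ * (W x * p2 x) := by
    intro x
    rw [hfluxW x]
    by_cases hWx : W x = 0
    · simp only [hWx, zero_mul, mul_zero, le_refl]
    have hxK : x ∈ K := hWK x hWx
    have h1 : ∑ μ, Cur μ x * n x μ ≤ ∑ _μ : Fin 4, CJ * p2 x := by
      refine Finset.sum_le_sum fun μ _ ↦ ?_
      have ha := abs_apply_le_one_of_mem_admissibleConormals (hnadm x) μ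
      have hb := hCurK x hxK μ
      calc Cur μ x * n x μ ≤ |Cur μ x * n x μ| := le_abs_self _
        _ = |Cur μ x| * |n x μ| := abs_mul _ _
        _ ≤ CJ * p2 x * 1 := mul_le_mul hb ha (abs_nonneg _) (by positivity)
        _ = CJ * p2 x := mul_one _
    have h2 : ∑ _μ : Fin 4, CJ * p2 x = 4 * (CJ * p2 x) := by
      simp only [Finset.sum_const, Finset.card_univ, Fintype.card_fin, nsmul_eq_mul, Nat.cast_ofNat]
    calc W x * ∑ μ, Cur μ x * n x μ ≤ W x * (4 * (CJ * p2 x)) :=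
          mul_le_mul_of_nonneg_left (h1.trans h2.le) (hW0 x)
      _ = 4 * CJ * (W x * p2 x) := by ring
  -- ### the divergence of the weighted current at the slab points of `K` (the equation is used
  -- only here: at points of `K ⊆ {r ≤ r₊ + η}` with `F(x⃗) ≤ x⁰`)
  have hdiv : ∀ x ∈ K, F (E4.spatial x) ≤ x 0 → x 0 ≤ s + F (E4.spatial x) →
      ∑ μ, fderiv ℝ (J μ) x (E4.basisVector μ) ≤ -ℓ x + e x := by
    intro x hxK hxF _
    have hxU : x ∈ U := hKU hxK
    obtain ⟨hNN, hN0, -⟩ := hcolK x hxK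
    exact redShift_weightedCurrent_divergence_le hMa hp0 hε hε₀pos hR₁pos hR12 hCJ0 hD0 hD hε₀D
      (hΦ x hxU) (hKr x hxK) (hsol x hxU (hKR₂ x hxK) hxF) hNN hN0
      (hcoer x ((hKabs x hxK).trans hηle₁) Φ) (hCurK x hxK)
  -- ### the energy inequality along the graph foliation
  have hmain := E4.graphFlux_add_integral_le_of_divergence_le hKc hJ1 hJ0 hF hρK hℓc hec hℓK he0
    hdiv hs le_rfl
  -- ### comparison of the four integrals
  have hgraph : ∀ t : ℝ, Continuous fun y : E3 ↦ E4.ofTimeSpace (t + F y) y := fun t ↦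
    E4.continuous_ofTimeSpace' (continuous_const.add hF.continuous) continuous_id
  have hF1 : ContDiff ℝ 1 F := hF.of_le one_le_two
  have hnc : ∀ μ, Continuous fun y : E3 ↦ graphConormal F y μ := by
    intro μ
    refine Fin.cases ?_ (fun i ↦ ?_) μ
    · simp only [graphConormal_zero]; exact continuous_const
    · simp only [graphConormal_succ, partialE3]
      exact ((hF1.continuous_fderiv one_ne_zero).clm_apply continuous_const).neg
  -- the weighted density `W ∑(∂Φ)²` is continuous on `ℝ⁴`
  have hWp2c : Continuous fun x ↦ W x * p2 x :=
    continuous_iff_continuousAt.mpr fun x ↦ continuousAt_weight_mul hKc hKU hW1.continuous hWz hp2c x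
  have hVp2c : Continuous fun x ↦ V x * p2 x :=
    continuous_iff_continuousAt.mpr fun x ↦ continuousAt_weight_mul hKshc hKshU hVc hVz hp2c x
  have hfluxc : ∀ t, Continuous fun y : E3 ↦
      ∑ μ, J μ (E4.ofTimeSpace (t + F y) y) * graphConormal F y μ := fun t ↦
    continuous_finsetSum _ fun μ _ ↦ ((hJ1 μ).continuous.comp (hgraph t)).mul (hnc μ)
  have hint : ∀ (g : E4 → ℝ), Continuous g → ∀ t,
      IntegrableOn (fun y : E3 ↦ g (E4.ofTimeSpace (t + F y) y)) (closedBall (0 : E3) ρ) :=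
    fun g hg t ↦ (hg.comp (hgraph t)).continuousOn.integrableOn_compact (isCompact_closedBall _ _)
  -- (a) the flux at time `s` from below
  have ha : A * c * (∫ y in closedBall (0 : E3) ρ, W (E4.ofTimeSpace (s + F y) y) *
      p2 (E4.ofTimeSpace (s + F y) y)) ≤
      ∫ y in closedBall (0 : E3) ρ, ∑ μ, J μ (E4.ofTimeSpace (s + F y) y) * graphConormal F y μ := by
    rw [← integral_const_mul]
    refine setIntegral_mono_on ((hint _ hWp2c s).const_mul _)
      ((hfluxc s).continuousOn.integrableOn_compact (isCompact_closedBall _ _))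
      measurableSet_closedBall fun y _ ↦ ?_
    have h := hqlow (E4.ofTimeSpace (s + F y) y)
    simp only [hn, E4.spatial_ofTimeSpace] at h
    exact h
  -- (b) the flux at time `0` from above
  have hb : (∫ y in closedBall (0 : E3) ρ, ∑ μ, J μ (E4.ofTimeSpace (0 + F y) y) *
      graphConormal F y μ) ≤ 4 * CJ * ∫ y in closedBall (0 : E3) ρ,
        W (E4.ofTimeSpace (0 + F y) y) * p2 (E4.ofTimeSpace (0 + F y) y) := by
    rw [← integral_const_mul]
    refine setIntegral_mono_on
      ((hfluxc 0).continuousOn.integrableOn_compact (isCompact_closedBall _ _))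
      ((hint _ hWp2c 0).const_mul _) measurableSet_closedBall fun y _ ↦ ?_
    have h := hqup (E4.ofTimeSpace (0 + F y) y)
    simp only [hn, E4.spatial_ofTimeSpace] at h
    exact h
  -- (c) the bulk integrals
  have hcℓ : (∫ u in Set.Ioc 0 s, ∫ y in closedBall (0 : E3) ρ, ℓ (E4.ofTimeSpace (u + F y) y)) =
      b₁ / 2 * ∫ u in Set.Ioc 0 s, ∫ y in closedBall (0 : E3) ρ,
        W (E4.ofTimeSpace (u + F y) y) * p2 (E4.ofTimeSpace (u + F y) y) := by
    simp only [hℓ, integral_const_mul]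
  have hce : (∫ u in Set.Ioc 0 s, ∫ y in closedBall (0 : E3) ρ, e (E4.ofTimeSpace (u + F y) y)) =
      4 * CJ * ∫ u in Set.Ioc 0 s, ∫ y in closedBall (0 : E3) ρ,
        V (E4.ofTimeSpace (u + F y) y) * p2 (E4.ofTimeSpace (u + F y) y) := by
    simp only [he, integral_const_mul]
  have hYnn : 0 ≤ ∫ u in Set.Ioc 0 s, ∫ y in closedBall (0 : E3) ρ,
      W (E4.ofTimeSpace (u + F y) y) * p2 (E4.ofTimeSpace (u + F y) y) :=
    setIntegral_nonneg measurableSet_Ioc fun u _ ↦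
      setIntegral_nonneg measurableSet_closedBall fun y _ ↦ mul_nonneg (hW0 _) (hp2nn _)
  have hcA : A * (∫ u in Set.Ioc 0 s, ∫ y in closedBall (0 : E3) ρ,
      W (E4.ofTimeSpace (u + F y) y) * p2 (E4.ofTimeSpace (u + F y) y)) ≤
      ∫ u in Set.Ioc 0 s, ∫ y in closedBall (0 : E3) ρ, ℓ (E4.ofTimeSpace (u + F y) y) := by
    rw [hcℓ]
    exact mul_le_mul_of_nonneg_right hAb hYnn
  -- ### conclusion
  have hfin := add_le_add ha hcA
  have hfin' := add_le_add_right hb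
    (∫ u in Set.Ioc 0 s, ∫ y in closedBall (0 : E3) ρ, e (E4.ofTimeSpace (u + F y) y))
  rw [hce] at hfin' hmain
  simp only [hp2] at hfin hfin' hmain ⊢
  linarith

end Summit.FinalStateConjecture.FinalStateConjecture.Cruxes.AdiabaticMultiKerrILED.Sketch
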